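import Summits.Ventures.LatticeQCDFlow.Exactness.IMHCommonRandomNumbersMeetingTimeGeometric
import Summits.Ventures.LatticeQCDFlow.Exactness.IMHCommonRandomNumbersDominance
import Summits.Ventures.LatticeQCDFlow.Exactness.IMHModeHolding
import HarnessLib

/-!
# The meeting time from TWO ARBITRARY STARTS is geometric with the acceptance probability of the HEAVIER start:
# `P(X_n ≠ X′_n) = (1 − A(x))ⁿ` and `P(T ≥ t) = (1 − A(x))^{t−1}` exactly, when the first run starts at `x` and the second starts lighter

HONEST FRAMING: exact (Metropolis-corrected) sampling algorithms for lattice gauge theory;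
figures of merit are autocorrelation/cost numbers at stated couplings and volumes; no
continuum-physics claim.

Venture `LatticeQCDFlow` (cell pub-lqcd), topic `Exactness`; FANOUT row 30 (lean-1, GEN-39).  NEW WORK of the cell, general state space
with `MeasurableSingletonClass Ω` and `MeasurableEq Ω`; sequel to GEN-37's `…Sharp` (the case `x = x₀` a mode: `P(X_n ≠ X′_n) = rⁿ` from
(cold, off-mode)), GEN-36's `…Dominance` (under common random numbers a lighter run stays lighter forever), GEN-31's `IMHModeHolding` (the
exact geometric holding law `Kᵗ(x, {x}) = (1 − A(x))ᵗ` at an atom-free point, `A(x) = imhAcceptMass q w x` the acceptance probability at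
`x`) and this generation's `…MeetingTimeGeometric` (`P(T ≥ t) = P(X_{t−1} ≠ X′_{t−1})` from every coupling; GEN-38 «NOT CLAIMED: the exact
law of `T` for two non-modal starts»).  THE MECHANISM: while the heavier run sits at `x` the two runs differ; the first time it accepts, the
lighter run accepts the same proposal (its threshold is lower) and the runs merge for good.  Setting: CRN pair kernel `K̂` of `K = indepMH q w`,
initial coupling `μ̂₀` with FIRST RUN AT `x` (`μ̂₀∘fst⁻¹ = δ_x`), SECOND RUN LIGHTER OR EQUAL (`μ̂₀{w(X′_0) ≤ w(X_0)} = 1`) and NOT AT `x`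
(`μ̂₀(X′_0 = x) = 0`), atom-free proposal at `x` (`q{x} = 0`):

* §1 **`crnPair_apply_moved_offDiagonal_eq_zero`** — pointwise: from an ordered pair `z` (`w z.2 ≤ w z.1`), `K̂ z {p | p.1 ≠ z.1, p ∉ Δ} = 0`
  (if the heavier run moves, both runs accepted the same proposal); **`crnPair_diag_offDiagonal_eq_zero`** — from the diagonal, `K̂ z Δᶜ = 0`.
* §2 **`iterate_bind_crnPair_offDiagonal_fst_ne_eq_zero`** — `P(X_n ≠ X′_n, X_n ≠ x) = 0` for every `n` (induction on the pair law);
  **`iterate_bind_crnPair_fst_at_eq`** — `P(X_n = x) = (1 − A(x))ⁿ` (and GEN-37's `iterate_bind_crnPair_snd_atMode_eq_zero`: `P(X′_n = x) = 0`).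
* §3 **`iterate_bind_crnPair_offDiagonal_ennreal_eq_holding`** ∕ **`iterate_bind_crnPair_offDiagonal_eq_holding`** — `P(X_n ≠ X′_n) = (1 − A(x))ⁿ`
  EXACTLY for every `n` (extended-real and real forms);
  **`crn_chain_totalDisagreement_tail_eq_twoStarts`** — `P(T ≥ t) = (1 − A(x))^{t−1}` (`t ≥ 1`): THE MEETING TIME IS GEOMETRIC WITH THE
  ACCEPTANCE PROBABILITY OF THE HEAVIER START (`w` normalised, maximal at some `x₀`, for the a.s. finiteness of `T`).
* §4 THE SWAP SYMMETRY OF COMMON RANDOM NUMBERS: **`crnPair_swap`** — `K̂(z.swap) = (K̂ z)∘swap⁻¹`; **`iterate_bind_crnPair_swap`** — the pair law from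
  the swapped coupling is the swapped pair law, at every time; hence the mirror statements with the SECOND run at `x` and the first run lighter:
  **`iterate_bind_crnPair_offDiagonal_eq_holding'`**, **`crn_chain_totalDisagreement_tail_eq_twoStarts'`**.
Reading (gauge files): two exact gauge samplers on one stream of random numbers started from two fixed configurations differ for a geometric
number of updates whose parameter is the acceptance probability of the sampler AT THE HEAVIER of the two starting configurations.
NOT CLAIMED: a random heavier start (the law is then a mixture of geometric laws — not typed); moments (they follow from the geometric law as in `…MeetingTimeTotal`, not re-typed); any value of `A(x)`.  No `sorry`,
no new definitions, nothing cited as a fact.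
-/

noncomputable section

namespace Summit.Ventures.LatticeQCDFlow.Exactness

open MeasureTheory ProbabilityTheory Function Finset Filter Set
open scoped ENNReal unitInterval Topology
open Summit.Ventures.LatticeQCDFlow.Scoring

variable {Ω : Type*} [MeasurableSpace Ω] {q : Measure Ω} [IsProbabilityMeasure q] {w : Ω → ℝ}

/-! ## §1 One step: the heavier run cannot move without merging -/

omit [IsProbabilityMeasure q] in
/-- **IF THE HEAVIER RUN MOVES, THE RUNS MERGE**: from an ordered pair `z` (`w z.2 ≤ w z.1`), `K̂ z {p | p.1 ≠ z.1 ∧ p.1 ≠ p.2} = 0` — the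
preimage of this event under the common-random-numbers update is empty. [ours] -/
theorem crnPair_apply_moved_offDiagonal_eq_zero [MeasurableEq Ω] (hw : Measurable w)
    (Khat : Kernel (Ω × Ω) (Ω × Ω))
    (hK : ∀ z : Ω × Ω, Khat z = (q.prod (volume : Measure unitInterval)).map (fun p : Ω × unitInterval =>
      ((if (p.2 : ℝ) * w z.1 ≤ w p.1 then p.1 else z.1), (if (p.2 : ℝ) * w z.2 ≤ w p.1 then p.1 else z.2))))
    {z : Ω × Ω} (hle : w z.2 ≤ w z.1) :
    Khat z {p : Ω × Ω | p.1 ≠ z.1 ∧ p.1 ≠ p.2} = 0 := by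
  have hS : MeasurableSet {p : Ω × Ω | p.1 ≠ z.1 ∧ p.1 ≠ p.2} :=
    (measurable_fst (measurableSet_singleton z.1)).compl.inter
      (measurableSet_diagonal (α := Ω)).compl
  rw [hK z, Measure.map_apply (measurable_crnPairUpdate_apply hw z) hS]
  have hempty : (fun p : Ω × unitInterval =>
      ((if (p.2 : ℝ) * w z.1 ≤ w p.1 then p.1 else z.1), (if (p.2 : ℝ) * w z.2 ≤ w p.1 then p.1 else z.2))) ⁻¹'
        {p : Ω × Ω | p.1 ≠ z.1 ∧ p.1 ≠ p.2} = ∅ := by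
    ext p
    simp only [Set.mem_preimage, Set.mem_setOf_eq, Set.mem_empty_iff_false, iff_false, not_and, not_not]
    intro hmoved
    -- the first run moved, so it accepted: `u·w(z.1) ≤ w(y)`; then `u·w(z.2) ≤ u·w(z.1) ≤ w(y)` and the second accepted too
    by_cases h1 : (p.2 : ℝ) * w z.1 ≤ w p.1
    · have h2 : (p.2 : ℝ) * w z.2 ≤ w p.1 := (mul_le_mul_of_nonneg_left hle p.2.2.1).trans h1
      rw [if_pos h1, if_pos h2]
    · exact absurd (by rw [if_neg h1]) hmoved
  rw [hempty, measure_empty]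

/-- From the diagonal the pair stays on the diagonal: `K̂ (y, y) Δᶜ = 0`. [ours, bookkeeping] -/
theorem crnPair_diag_offDiagonal_eq_zero [MeasurableEq Ω] (hw : Measurable w) (hw0 : ∀ y, 0 < w y)
    (Khat : Kernel (Ω × Ω) (Ω × Ω))
    (hK : ∀ z : Ω × Ω, Khat z = (q.prod (volume : Measure unitInterval)).map (fun p : Ω × unitInterval =>
      ((if (p.2 : ℝ) * w z.1 ≤ w p.1 then p.1 else z.1), (if (p.2 : ℝ) * w z.2 ≤ w p.1 then p.1 else z.2))))
    (y : Ω) : Khat (y, y) (Set.diagonal Ω)ᶜ = 0 := by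
  have hdiag : Measurable (fun v : Ω => (v, v)) := measurable_id.prodMk measurable_id
  rw [crnPair_diag_apply hw hw0 Khat hK y, Measure.map_apply hdiag (measurableSet_diagonal (α := Ω)).compl]
  have hempty : (fun v : Ω => (v, v)) ⁻¹' (Set.diagonal Ω)ᶜ = ∅ := by
    ext v; simp [Set.mem_diagonal_iff]
  rw [hempty, measure_empty]

/-! ## §2 The pair law: off the diagonal the first run is still at `x`; it is there with probability `(1 − A(x))ⁿ` -/

/-- **`P(X_n ≠ X′_n, X_n ≠ x) = 0` FOR EVERY `n`**: if the first run starts at `x` and the second starts lighter or equal, then at every time,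
almost surely, either the runs have merged or the first run is still at `x` (induction: ordered pairs stay ordered, the diagonal is
absorbing, and from an off-diagonal ordered pair at `x` the first run cannot move without merging). [ours] -/
theorem iterate_bind_crnPair_offDiagonal_fst_ne_eq_zero [MeasurableEq Ω] (hw : Measurable w) (hw0 : ∀ y, 0 < w y)
    (Khat : Kernel (Ω × Ω) (Ω × Ω)) [IsMarkovKernel Khat]
    (hK : ∀ z : Ω × Ω, Khat z = (q.prod (volume : Measure unitInterval)).map (fun p : Ω × unitInterval =>
      ((if (p.2 : ℝ) * w z.1 ≤ w p.1 then p.1 else z.1), (if (p.2 : ℝ) * w z.2 ≤ w p.1 then p.1 else z.2))))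
    {x : Ω} :
    ∀ (n : ℕ) (μ₀ : Measure (Ω × Ω)) [IsProbabilityMeasure μ₀], μ₀ {p : Ω × Ω | w p.2 ≤ w p.1} = 1 →
      μ₀ {p : Ω × Ω | p.1 ≠ p.2 ∧ p.1 ≠ x} = 0 →
        ((fun m : Measure (Ω × Ω) => m.bind Khat)^[n] μ₀) {p : Ω × Ω | p.1 ≠ p.2 ∧ p.1 ≠ x} = 0
  | 0, μ₀, _, _, h0 => h0
  | n + 1, μ₀, _, hord, h0 => by
    haveI : IsProbabilityMeasure (μ₀.bind Khat) :=
      ⟨by rw [Measure.bind_apply MeasurableSet.univ (Kernel.aemeasurable _)]; simp⟩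
    have hB : MeasurableSet {p : Ω × Ω | p.1 ≠ p.2 ∧ p.1 ≠ x} :=
      (measurableSet_diagonal (α := Ω)).compl.inter (measurable_fst (measurableSet_singleton x)).compl
    have hO : MeasurableSet {p : Ω × Ω | w p.2 ≤ w p.1} := measurableSet_le (hw.comp measurable_snd) (hw.comp measurable_fst)
    -- one step from `μ₀`: the event has probability zero under `μ₀K̂`
    have hstep : (μ₀.bind Khat) {p : Ω × Ω | p.1 ≠ p.2 ∧ p.1 ≠ x} = 0 := by
      rw [Measure.bind_apply hB (Kernel.aemeasurable _)]
      have hae : ∀ᵐ z ∂μ₀, Khat z {p : Ω × Ω | p.1 ≠ p.2 ∧ p.1 ≠ x} = 0 := by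
        have h1 : ∀ᵐ z ∂μ₀, z ∈ {p : Ω × Ω | w p.2 ≤ w p.1} :=
          (ae_iff_measure_eq hO.nullMeasurableSet).2 (by rw [hord, measure_univ])
        have h2 : ∀ᵐ z ∂μ₀, z ∉ {p : Ω × Ω | p.1 ≠ p.2 ∧ p.1 ≠ x} := measure_eq_zero_iff_ae_notMem.1 h0
        filter_upwards [h1, h2] with z hz1 hz2
        simp only [not_and, not_not] at hz1 hz2
        by_cases hd : z.1 = z.2
        · -- on the diagonal: the pair stays on the diagonal
          refine le_antisymm ?_ bot_le
          have hz : z = (z.1, z.1) := Prod.ext rfl hd.symm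
          calc Khat z {p : Ω × Ω | p.1 ≠ p.2 ∧ p.1 ≠ x} ≤ Khat z (Set.diagonal Ω)ᶜ :=
                measure_mono fun p hp => fun hpd => hp.1 (Set.mem_diagonal_iff.1 hpd)
            _ = 0 := by rw [hz]; exact crnPair_diag_offDiagonal_eq_zero hw hw0 Khat hK z.1
        · -- off the diagonal the first run is at `x`: moving means merging
          have hx : z.1 = x := hz2 hd
          refine le_antisymm ?_ bot_le
          calc Khat z {p : Ω × Ω | p.1 ≠ p.2 ∧ p.1 ≠ x} ≤ Khat z {p : Ω × Ω | p.1 ≠ z.1 ∧ p.1 ≠ p.2} :=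
                measure_mono fun p hp => ⟨hx ▸ hp.2, hp.1⟩
            _ = 0 := crnPair_apply_moved_offDiagonal_eq_zero hw Khat hK hz1
      rw [lintegral_congr_ae hae, lintegral_zero]
    rw [Function.iterate_succ_apply]
    exact iterate_bind_crnPair_offDiagonal_fst_ne_eq_zero hw hw0 Khat hK n (μ₀.bind Khat)
      (bind_crnPair_weightOrder hw hw0 Khat hK μ₀ hord) hstep

/-- **`P(X_n = x) = (1 − A(x))ⁿ` EXACTLY** when the first run starts at `x` and `q{x} = 0` (GEN-31's holding law read on the pair chain).
[ours] -/
theorem iterate_bind_crnPair_fst_at_eq [MeasurableSingletonClass Ω] (hw : Measurable w) (hw0 : ∀ y, 0 < w y) {x : Ω}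
    (hqx : q {x} = 0) (Khat : Kernel (Ω × Ω) (Ω × Ω)) [IsMarkovKernel Khat]
    (hK : ∀ z : Ω × Ω, Khat z = (q.prod (volume : Measure unitInterval)).map (fun p : Ω × unitInterval =>
      ((if (p.2 : ℝ) * w z.1 ≤ w p.1 then p.1 else z.1), (if (p.2 : ℝ) * w z.2 ≤ w p.1 then p.1 else z.2))))
    (n : ℕ) (μ₀ : Measure (Ω × Ω)) [IsProbabilityMeasure μ₀] (hfst : μ₀.map Prod.fst = Measure.dirac x) :
    ((fun m : Measure (Ω × Ω) => m.bind Khat)^[n] μ₀) {p | p.1 = x} = (1 - imhAcceptMass q w x) ^ n := by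
  have hset : {p : Ω × Ω | p.1 = x} = Prod.fst ⁻¹' {x} := by ext p; simp
  rw [hset, ← Measure.map_apply measurable_fst (measurableSet_singleton x), iterate_bind_crnPair_map_fst hw hw0 Khat hK n μ₀, hfst,
    iterate_bind_indepMH_dirac_singleton_eq hw hqx n]

/-! ## §3 The exact law of the meeting time from two starts -/

/-- **`P(X_n ≠ X′_n) = (1 − A(x))ⁿ` EXACTLY FOR EVERY `n`, extended-real form**: first run at `x` (`μ̂₀∘fst⁻¹ = δ_x`), second run lighter or
equal (`μ̂₀{w(X′_0) ≤ w(X_0)} = 1`) and not at `x` (`μ̂₀(X′_0 = x) = 0`), atom-free proposal at `x`; `A(x) = imhAcceptMass q w x`. [ours] -/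
theorem iterate_bind_crnPair_offDiagonal_ennreal_eq_holding [MeasurableSingletonClass Ω] [MeasurableEq Ω] (hw : Measurable w)
    (hw0 : ∀ y, 0 < w y) {x : Ω} (hqx : q {x} = 0) (Khat : Kernel (Ω × Ω) (Ω × Ω)) [IsMarkovKernel Khat]
    (hK : ∀ z : Ω × Ω, Khat z = (q.prod (volume : Measure unitInterval)).map (fun p : Ω × unitInterval =>
      ((if (p.2 : ℝ) * w z.1 ≤ w p.1 then p.1 else z.1), (if (p.2 : ℝ) * w z.2 ≤ w p.1 then p.1 else z.2))))
    (n : ℕ) (μ₀ : Measure (Ω × Ω)) [IsProbabilityMeasure μ₀] (hfst : μ₀.map Prod.fst = Measure.dirac x)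
    (hord : μ₀ {p : Ω × Ω | w p.2 ≤ w p.1} = 1) (hsnd : (μ₀.map Prod.snd) {x} = 0) :
    ((fun m : Measure (Ω × Ω) => m.bind Khat)^[n] μ₀) (Set.diagonal Ω)ᶜ = (1 - imhAcceptMass q w x) ^ n := by
  haveI hP : IsProbabilityMeasure ((fun m : Measure (Ω × Ω) => m.bind Khat)^[n] μ₀) :=
    isProbabilityMeasure_iterate_bind (κ := Khat) μ₀ n
  set P : Measure (Ω × Ω) := (fun m : Measure (Ω × Ω) => m.bind Khat)^[n] μ₀ with hPdef
  haveI : IsProbabilityMeasure (μ₀.map Prod.snd) := Measure.isProbabilityMeasure_map measurable_snd.aemeasurable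
  -- the initial coupling charges no off-diagonal pair whose first coordinate is not `x`
  have h0 : μ₀ {p : Ω × Ω | p.1 ≠ p.2 ∧ p.1 ≠ x} = 0 := by
    refine le_antisymm ?_ bot_le
    have hfx : μ₀ {p : Ω × Ω | p.1 ≠ x} = 0 := by
      have hset : {p : Ω × Ω | p.1 ≠ x} = Prod.fst ⁻¹' ({x}ᶜ) := by ext p; simp
      rw [hset, ← Measure.map_apply measurable_fst (measurableSet_singleton x).compl, hfst,
        Measure.dirac_apply' _ (measurableSet_singleton x).compl]
      simp
    calc μ₀ {p : Ω × Ω | p.1 ≠ p.2 ∧ p.1 ≠ x} ≤ μ₀ {p : Ω × Ω | p.1 ≠ x} := measure_mono fun p hp => hp.2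
      _ = 0 := hfx
  have hB0 : P {p : Ω × Ω | p.1 ≠ p.2 ∧ p.1 ≠ x} = 0 :=
    iterate_bind_crnPair_offDiagonal_fst_ne_eq_zero hw hw0 Khat hK n μ₀ hord h0
  have hfstx : P {p | p.1 = x} = (1 - imhAcceptMass q w x) ^ n := iterate_bind_crnPair_fst_at_eq hw hw0 hqx Khat hK n μ₀ hfst
  have hsndx : P {p | p.2 = x} = 0 := iterate_bind_crnPair_snd_atMode_eq_zero hw hw0 hqx Khat hK n μ₀ hsnd
  -- `Δᶜ` and `{X_n = x}` differ by null sets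
  have hle1 : P (Set.diagonal Ω)ᶜ ≤ P {p | p.1 = x} := by
    calc P (Set.diagonal Ω)ᶜ ≤ P ({p | p.1 = x} ∪ {p : Ω × Ω | p.1 ≠ p.2 ∧ p.1 ≠ x}) := measure_mono fun p hp => by
          by_cases h : p.1 = x
          · exact Or.inl h
          · exact Or.inr ⟨fun h' => hp (Set.mem_diagonal_iff.2 h'), h⟩
      _ ≤ P {p | p.1 = x} + P {p : Ω × Ω | p.1 ≠ p.2 ∧ p.1 ≠ x} := measure_union_le _ _
      _ = P {p | p.1 = x} := by rw [hB0, add_zero]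
  have hle2 : P {p | p.1 = x} ≤ P (Set.diagonal Ω)ᶜ := by
    calc P {p | p.1 = x} ≤ P ((Set.diagonal Ω)ᶜ ∪ {p | p.2 = x}) := measure_mono fun p hp => by
          by_cases h : p ∈ Set.diagonal Ω
          · right
            show p.2 = x
            rw [← Set.mem_diagonal_iff.1 h]; exact hp
          · exact Or.inl h
      _ ≤ P (Set.diagonal Ω)ᶜ + P {p | p.2 = x} := measure_union_le _ _
      _ = P (Set.diagonal Ω)ᶜ := by rw [hsndx, add_zero]
  rw [← hfstx]; exact le_antisymm hle1 hle2

/-- **`P(X_n ≠ X′_n) = (1 − A(x))ⁿ` EXACTLY FOR EVERY `n`** (real form): first run at `x` (`μ̂₀∘fst⁻¹ = δ_x`), second run lighter or equal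
(`μ̂₀{w(X′_0) ≤ w(X_0)} = 1`) and not at `x` (`μ̂₀(X′_0 = x) = 0`), atom-free proposal at `x`. [ours] -/
theorem iterate_bind_crnPair_offDiagonal_eq_holding [MeasurableSingletonClass Ω] [MeasurableEq Ω] (hw : Measurable w)
    (hw0 : ∀ y, 0 < w y) {x : Ω} (hqx : q {x} = 0) (Khat : Kernel (Ω × Ω) (Ω × Ω)) [IsMarkovKernel Khat]
    (hK : ∀ z : Ω × Ω, Khat z = (q.prod (volume : Measure unitInterval)).map (fun p : Ω × unitInterval =>
      ((if (p.2 : ℝ) * w z.1 ≤ w p.1 then p.1 else z.1), (if (p.2 : ℝ) * w z.2 ≤ w p.1 then p.1 else z.2))))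
    (n : ℕ) (μ₀ : Measure (Ω × Ω)) [IsProbabilityMeasure μ₀] (hfst : μ₀.map Prod.fst = Measure.dirac x)
    (hord : μ₀ {p : Ω × Ω | w p.2 ≤ w p.1} = 1) (hsnd : (μ₀.map Prod.snd) {x} = 0) :
    ((fun m : Measure (Ω × Ω) => m.bind Khat)^[n] μ₀).real (Set.diagonal Ω)ᶜ = (1 - (imhAcceptMass q w x).toReal) ^ n := by
  have hA1 : imhAcceptMass q w x ≤ 1 := imhAcceptMass_le_one (q := q) (w := w) x
  rw [measureReal_def, iterate_bind_crnPair_offDiagonal_ennreal_eq_holding hw hw0 hqx Khat hK n μ₀ hfst hord hsnd, ENNReal.toReal_pow,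
    ENNReal.toReal_sub_of_le hA1 ENNReal.one_ne_top, ENNReal.toReal_one]

/-- **THE MEETING TIME FROM TWO STARTS IS GEOMETRIC WITH THE ACCEPTANCE PROBABILITY OF THE HEAVIER START**: in the setting of
`iterate_bind_crnPair_offDiagonal_eq_holding`, with `w` normalised and maximal at some `x₀` (so that `T` is a.s. finite),
`P(T ≥ t) = (1 − A(x))^{t−1}` EXACTLY for every `t ≥ 1`. [ours] -/
theorem crn_chain_totalDisagreement_tail_eq_twoStarts [MeasurableSingletonClass Ω] [MeasurableEq Ω] (hw : Measurable w)
    (hw0 : ∀ y, 0 < w y) {x₀ : Ω} (hmax : ∀ y, w y ≤ w x₀) [IsProbabilityMeasure (q.withDensity fun y => ENNReal.ofReal (w y))]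
    {x : Ω} (hqx : q {x} = 0) (Khat : Kernel (Ω × Ω) (Ω × Ω)) [IsMarkovKernel Khat]
    (hK : ∀ z : Ω × Ω, Khat z = (q.prod (volume : Measure unitInterval)).map (fun p : Ω × unitInterval =>
      ((if (p.2 : ℝ) * w z.1 ≤ w p.1 then p.1 else z.1), (if (p.2 : ℝ) * w z.2 ≤ w p.1 then p.1 else z.2))))
    (μ₀ : Measure (Ω × Ω)) [IsProbabilityMeasure μ₀] (hfst : μ₀.map Prod.fst = Measure.dirac x)
    (hord : μ₀ {p : Ω × Ω | w p.2 ≤ w p.1} = 1) (hsnd : (μ₀.map Prod.snd) {x} = 0) {t : ℕ} (ht : 1 ≤ t) :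
    (Kernel.trajMeasure (X := fun _ : ℕ => Ω × Ω) μ₀
          (fun n : ℕ => Khat.comap (fun h : (i : ↥(Finset.Iic n)) → Ω × Ω => h ⟨n, Finset.mem_Iic.2 le_rfl⟩)
            (measurable_pi_apply _))).real
        {z | (t : ℝ) ≤ ∑' n, (Set.diagonal Ω)ᶜ.indicator (1 : Ω × Ω → ℝ) (z n)} = (1 - (imhAcceptMass q w x).toReal) ^ (t - 1) := by
  rw [crn_chain_totalDisagreement_tail_eq hw hw0 hmax Khat hK μ₀ ht]
  exact iterate_bind_crnPair_offDiagonal_eq_holding hw hw0 hqx Khat hK (t - 1) μ₀ hfst hord hsnd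

/-! ## §4 The swap symmetry: the second run at `x`, the first run lighter -/

omit [IsProbabilityMeasure q] in
/-- **COMMON RANDOM NUMBERS ARE SWAP-SYMMETRIC**: `K̂ (z.swap) = (K̂ z).map swap` — both runs are fed the same proposal and the same uniform.
[ours, bookkeeping] -/
theorem crnPair_swap (hw : Measurable w) (Khat : Kernel (Ω × Ω) (Ω × Ω))
    (hK : ∀ z : Ω × Ω, Khat z = (q.prod (volume : Measure unitInterval)).map (fun p : Ω × unitInterval =>
      ((if (p.2 : ℝ) * w z.1 ≤ w p.1 then p.1 else z.1), (if (p.2 : ℝ) * w z.2 ≤ w p.1 then p.1 else z.2))))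
    (z : Ω × Ω) : Khat z.swap = (Khat z).map Prod.swap := by
  rw [hK z.swap, hK z, Measure.map_map measurable_swap (measurable_crnPairUpdate_apply hw z)]
  rfl

omit [IsProbabilityMeasure q] in
/-- **THE PAIR LAW FROM THE SWAPPED COUPLING IS THE SWAPPED PAIR LAW**, at every time. [ours, bookkeeping] -/
theorem iterate_bind_crnPair_swap (hw : Measurable w) (Khat : Kernel (Ω × Ω) (Ω × Ω)) [IsMarkovKernel Khat]
    (hK : ∀ z : Ω × Ω, Khat z = (q.prod (volume : Measure unitInterval)).map (fun p : Ω × unitInterval =>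
      ((if (p.2 : ℝ) * w z.1 ≤ w p.1 then p.1 else z.1), (if (p.2 : ℝ) * w z.2 ≤ w p.1 then p.1 else z.2)))) :
    ∀ (n : ℕ) (μ₀ : Measure (Ω × Ω)),
      (fun m : Measure (Ω × Ω) => m.bind Khat)^[n] (μ₀.map Prod.swap) = (((fun m : Measure (Ω × Ω) => m.bind Khat)^[n] μ₀)).map Prod.swap
  | 0, μ₀ => rfl
  | n + 1, μ₀ => by
    have hstep : ∀ m : Measure (Ω × Ω), (m.map Prod.swap).bind Khat = (m.bind Khat).map Prod.swap := by
      intro m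
      ext S hS
      rw [Measure.bind_apply hS (Kernel.aemeasurable _), lintegral_map (Kernel.measurable_coe Khat hS) measurable_swap,
        Measure.map_apply measurable_swap hS, Measure.bind_apply (measurable_swap hS) (Kernel.aemeasurable _)]
      refine lintegral_congr fun z => ?_
      rw [crnPair_swap hw Khat hK z, Measure.map_apply measurable_swap hS]
    rw [Function.iterate_succ_apply, Function.iterate_succ_apply, hstep, iterate_bind_crnPair_swap hw Khat hK n]

/-- **`P(X_n ≠ X′_n) = (1 − A(x))ⁿ` EXACTLY, MIRRORED**: SECOND run at `x` (`μ̂₀∘snd⁻¹ = δ_x`), FIRST run lighter or equal (`μ̂₀{w(X_0) ≤ w(X′_0)} = 1`)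
and not at `x` (`μ̂₀(X_0 = x) = 0`), atom-free proposal at `x`. [ours] -/
theorem iterate_bind_crnPair_offDiagonal_eq_holding' [MeasurableSingletonClass Ω] [MeasurableEq Ω] (hw : Measurable w)
    (hw0 : ∀ y, 0 < w y) {x : Ω} (hqx : q {x} = 0) (Khat : Kernel (Ω × Ω) (Ω × Ω)) [IsMarkovKernel Khat]
    (hK : ∀ z : Ω × Ω, Khat z = (q.prod (volume : Measure unitInterval)).map (fun p : Ω × unitInterval =>
      ((if (p.2 : ℝ) * w z.1 ≤ w p.1 then p.1 else z.1), (if (p.2 : ℝ) * w z.2 ≤ w p.1 then p.1 else z.2))))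
    (n : ℕ) (μ₀ : Measure (Ω × Ω)) [IsProbabilityMeasure μ₀] (hsnd : μ₀.map Prod.snd = Measure.dirac x)
    (hord : μ₀ {p : Ω × Ω | w p.1 ≤ w p.2} = 1) (hfst : (μ₀.map Prod.fst) {x} = 0) :
    ((fun m : Measure (Ω × Ω) => m.bind Khat)^[n] μ₀).real (Set.diagonal Ω)ᶜ = (1 - (imhAcceptMass q w x).toReal) ^ n := by
  haveI : IsProbabilityMeasure (μ₀.map Prod.swap) := Measure.isProbabilityMeasure_map measurable_swap.aemeasurable
  have hO : MeasurableSet {p : Ω × Ω | w p.2 ≤ w p.1} := measurableSet_le (hw.comp measurable_snd) (hw.comp measurable_fst)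
  -- the swapped coupling satisfies the hypotheses of §3
  have h := iterate_bind_crnPair_offDiagonal_eq_holding hw hw0 hqx Khat hK n (μ₀.map Prod.swap)
    (by rw [Measure.map_map measurable_fst measurable_swap]; exact hsnd)
    (by rw [Measure.map_apply measurable_swap hO]; exact hord)
    (by rw [Measure.map_map measurable_snd measurable_swap]; exact hfst)
  have hpre : Prod.swap ⁻¹' (Set.diagonal Ω)ᶜ = (Set.diagonal Ω)ᶜ := by
    ext p; simp [Set.mem_diagonal_iff, eq_comm]
  rw [iterate_bind_crnPair_swap hw Khat hK n μ₀, measureReal_def,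
    Measure.map_apply measurable_swap (measurableSet_diagonal (α := Ω)).compl, hpre] at h
  rw [measureReal_def]
  exact h

/-- **THE MEETING TIME FROM TWO STARTS IS GEOMETRIC, MIRRORED**: second run at `x`, first run lighter or equal and not at `x`; `w` normalised, maximal at
some `x₀`; then `P(T ≥ t) = (1 − A(x))^{t−1}` EXACTLY for every `t ≥ 1`. [ours] -/
theorem crn_chain_totalDisagreement_tail_eq_twoStarts' [MeasurableSingletonClass Ω] [MeasurableEq Ω] (hw : Measurable w)
    (hw0 : ∀ y, 0 < w y) {x₀ : Ω} (hmax : ∀ y, w y ≤ w x₀) [IsProbabilityMeasure (q.withDensity fun y => ENNReal.ofReal (w y))]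
    {x : Ω} (hqx : q {x} = 0) (Khat : Kernel (Ω × Ω) (Ω × Ω)) [IsMarkovKernel Khat]
    (hK : ∀ z : Ω × Ω, Khat z = (q.prod (volume : Measure unitInterval)).map (fun p : Ω × unitInterval =>
      ((if (p.2 : ℝ) * w z.1 ≤ w p.1 then p.1 else z.1), (if (p.2 : ℝ) * w z.2 ≤ w p.1 then p.1 else z.2))))
    (μ₀ : Measure (Ω × Ω)) [IsProbabilityMeasure μ₀] (hsnd : μ₀.map Prod.snd = Measure.dirac x)
    (hord : μ₀ {p : Ω × Ω | w p.1 ≤ w p.2} = 1) (hfst : (μ₀.map Prod.fst) {x} = 0) {t : ℕ} (ht : 1 ≤ t) :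
    (Kernel.trajMeasure (X := fun _ : ℕ => Ω × Ω) μ₀
          (fun n : ℕ => Khat.comap (fun h : (i : ↥(Finset.Iic n)) → Ω × Ω => h ⟨n, Finset.mem_Iic.2 le_rfl⟩)
            (measurable_pi_apply _))).real
        {z | (t : ℝ) ≤ ∑' n, (Set.diagonal Ω)ᶜ.indicator (1 : Ω × Ω → ℝ) (z n)} = (1 - (imhAcceptMass q w x).toReal) ^ (t - 1) := by
  rw [crn_chain_totalDisagreement_tail_eq hw hw0 hmax Khat hK μ₀ ht]
  exact iterate_bind_crnPair_offDiagonal_eq_holding' hw hw0 hqx Khat hK (t - 1) μ₀ hsnd hord hfst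

end Summit.Ventures.LatticeQCDFlow.Exactness

end
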